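import Mathlib.AlgebraicGeometry.Morphisms.Flat
import Mathlib.AlgebraicGeometry.Morphisms.Affine
import Mathlib.CategoryTheory.Monoidal.Cartesian.Over
import Literature.NumberTheory.DiophantineGeometry.AVIsogenyQuasiInverse
import HarnessLib

/-!
# Isogenies of abelian varieties are flat

This file proves the named fact `Literature.AlgebraicGeometry.Motives.AbelianVariety.IsIsogeny.flat_toSchemeHom`
(`Literature/NumberTheory/DiophantineGeometry/AVIsogenyQuasiInverse.lean`): the underlying
morphism of schemes of an isogeny `f : A → B` of abelian varieties over a field `K` is flat
(Görtz–Wedhorn, *Algebraic Geometry II*, Prop. 27.54 — a surjective homomorphism `G → H` of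
separated group schemes locally of finite presentation over `S`, with `G` flat over `S` and `H`
with geometrically reduced fibres, is faithfully flat — specialised to isogenies of abelian
varieties over `S = Spec K`, cf. p. 882 (1) and Cor. 27.177; Mumford, *Abelian Varieties*, §12).

## The proof

We do not follow the printed proof of Görtz–Wedhorn II, Prop. 27.54, which rests on
Prop. 27.14 (3) (PDF p. 804 of the held copy: generic flatness plus translations by points over an
algebraic closure), for lack of generic flatness in Mathlib.
Instead, since an isogeny is *finite*, flatness is a statement about a finite algebra `R → S`
over a *reduced* ring `R` (an affine open of the integral scheme `B`), and such an algebra is flat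
as soon as its fibre rank `p ↦ dim_{κ(p)} (κ(p) ⊗_R S)` is constant on `Spec R`
(`Literature.NumberTheory.DiophantineGeometry.FibreRank.flat_of_fibreRank_eq_const`; Hartshorne II, Ex. 5.8 (c); Görtz–Wedhorn I
(2nd ed.), Cor. 11.19 for the rank function (11.8.1) — proved here for modules, without
noetherian hypotheses, via Nakayama and `Module.flat_of_localized_maximal`). The fibre rank is
constant, equal to `dim_K Γ(Ker f, 𝒪)`, because of the **translation isomorphism**
`A ×_{B} F ≅ F ×_K Ker f` over `F` for any `F → A` (`Literature.AlgebraicGeometry.Motives.AbelianVariety.transIso`, the scheme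
version of `f⁻¹(f(x)) = x · Ker f`; Görtz–Wedhorn II, (27.9.1) in Lemma 27.59, PDF p. 822),
applied to the fibre `F` of `f` over a point and combined with the computation of global
sections of fibre products of affine schemes as tensor products
(Mathlib `isPushout_appTop_of_isPullback`).

## Design notes

* `Hom.ker f` is the plain scheme `A ×_{B, e_B} Spec K` (an `abbrev` for a `pullback`), with its
  two projections `Hom.kerι f : Ker f → A` and `Hom.kerToSpec f : Ker f → Spec K`; no group-scheme
  structure on it is needed here. Its `T`-points are the `kerPoints T f` of
  `AVIsogenyQuasiInverse` (not used in this file).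
* The group law enters only through `divPt`/`mulPt`, the morphisms `x⁻¹ b`, `x c : Z → A` built
  from Mathlib's group structure `Hom.group` on `(Over.mk (x ≫ A.X.hom) ⟶ A.X)`, and the lemmas
  `MonObj.comp_mul`, `GrpObj.comp_inv`, `IsMonHom.monoidHom`.
* `isoSpec_inv_appTop` is a small missing Mathlib lemma, kept in the `Literature.AlgebraicGeometry.Motives.AbelianVariety`
  namespace.
* Mathlib searched: `Module.flat_of_localized_maximal`, `IsLocalRing.span_eq_top_of_tmul_eq_basis`,
  `isPushout_appTop_of_isPullback`, `CommRingCat.isPushout_iff_isPushout`,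
  `Algebra.IsPushout.equiv`, `pullbackLeftPullbackSndIso`, `HasRingHomProperty.iff_of_isAffine`,
  `IsZariskiLocalAtTarget.of_openCover`, `Scheme.Hom.finite_appTop` (all used); Mathlib has the
  rank of a *flat* finite morphism (`Scheme.Hom.finrank`, `Module.rankAtStalk`) but not the
  criterion "constant fibre rank over a reduced base ⇒ flat", nor kernels of group-scheme
  homomorphisms.

## Main statements

* `Literature.NumberTheory.DiophantineGeometry.FibreRank.flat_of_fibreRank_eq_const`: constant fibre rank over a reduced ring ⇒ flat.
* `Literature.AlgebraicGeometry.Motives.AbelianVariety.transIso`: `A ×_B F ≅ F ×_K Ker f` over `F`.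
* `Literature.AlgebraicGeometry.Motives.AbelianVariety.IsIsogeny.fibreRank_eq_kerRank`: the fibre rank of an isogeny over any
  affine `U → B` is the constant `kerRank f = dim_K Γ(Ker f, 𝒪)`.
* `Literature.AlgebraicGeometry.Motives.AbelianVariety.IsIsogeny.flat_toSchemeHom_holds`: **isogenies are flat** (discharges the
  named fact `IsIsogeny.flat_toSchemeHom`).
* `Literature.AlgebraicGeometry.Motives.AbelianVariety.IsIsogeny.exists_comp_eq_of_kerPoints_le_holds`: hence the quotient property
  `IsIsogeny.exists_comp_eq_of_kerPoints_le` holds unconditionally, and the quasi-inverse fact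
  `IsIsogeny.exists_nsmul_inverse` is reduced to Deligne's theorem alone
  (`IsIsogeny.exists_nsmul_inverse_of_exists_kerPoints_le_nsmul`).

## References

* U. Görtz, T. Wedhorn, *Algebraic Geometry I* (2nd ed. 2020): the rank function (11.8.1)
  (PDF p. 370 of the held copy), Cor. 11.19 (reduced + locally constant rank ⇒ locally free,
  PDF p. 372; no noetherian hypothesis), Cor. 7.31 (upper semicontinuity, PDF p. 238);
  *Algebraic Geometry II* (2023): (27.1.1) (kernels, PDF p. 800), Prop. 27.14 (3) (PDF p. 804),
  (27.9.1) in Lemma 27.59 (PDF p. 822), Prop. 27.54 (PDF p. 821), Cor. 27.177 (PDF p. 882).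
* R. Hartshorne, *Algebraic Geometry*, II Ex. 5.8 (for `R` noetherian).
* D. Mumford, *Abelian Varieties* (1970), §12.
-/

universe u

open CategoryTheory CategoryTheory.Limits AlgebraicGeometry MonoidalCategory TensorProduct

noncomputable section

/-! ### Constant fibre rank over a reduced ring implies flat -/

namespace Literature.NumberTheory.DiophantineGeometry

namespace FibreRank

open Module

universe v

variable {R : Type u} [CommRing R] {M : Type v} [AddCommGroup M] [Module R M]

/-- The fibre rank `dim_{κ(p)} (κ(p) ⊗_R M)` of a module at a prime (the rank function
`rk_x(F) := dim_{κ(x)} F(x)` of Görtz–Wedhorn I, (11.8.1), for `F = M~` on `Spec R`; Hartshorne II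
Ex. 5.8); `κ(p) ⊗_R M` is Mathlib's fibre `p.asIdeal.Fiber M`. [folklore] -/
abbrev fibreRank (M : Type v) [AddCommGroup M] [Module R M] (p : PrimeSpectrum R) :
    ℕ :=
  Module.finrank p.asIdeal.ResidueField (p.asIdeal.ResidueField ⊗[R] M)

/-- The fibre rank may be computed after any further field extension `K → L`. [folklore] -/
theorem finrank_tensor_eq_of_isScalarTower (K L : Type*) [Field K] [Field L] [Algebra R K]
    [Algebra R L] [Algebra K L] [IsScalarTower R K L] [Module.Finite R M] :
    Module.finrank L (L ⊗[R] M) = Module.finrank K (K ⊗[R] M) := by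
  rw [← Module.finrank_baseChange (R := L) (M' := K ⊗[R] M)]
  exact (LinearEquiv.finrank_eq (TensorProduct.AlgebraTensorModule.cancelBaseChange R K L L M)).symm

/-- **Local case.** Over a reduced local ring, a finite module all of whose fibre ranks equal
the fibre rank at the closed point is free: lift a basis of `k ⊗ M` to a surjection `Rʳ → M`
(Nakayama); a relation has coordinates in every prime (compare dimensions over `κ(q)`), hence
in the nilradical, hence zero (Hartshorne II Ex. 5.8 (c); Görtz–Wedhorn I, Cor. 11.19, local case).
[folklore] -/
theorem free_of_fibreRank_eq [IsLocalRing R] [IsReduced R] [Module.Finite R M]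
    (h : ∀ q : PrimeSpectrum R, fibreRank M q =
      Module.finrank (IsLocalRing.ResidueField R) (IsLocalRing.ResidueField R ⊗[R] M)) :
    Module.Free R M := by
  classical
  set s := Module.finrank (IsLocalRing.ResidueField R) (IsLocalRing.ResidueField R ⊗[R] M)
  let b : Basis (Fin s) (IsLocalRing.ResidueField R) (IsLocalRing.ResidueField R ⊗[R] M) :=
    Module.finBasis _ _
  obtain ⟨v, hv⟩ : ∃ v : Fin s → M, ∀ i, (1 : IsLocalRing.ResidueField R) ⊗ₜ v i = b i :=
    ⟨fun i ↦ (TensorProduct.mk_surjective R M _ Ideal.Quotient.mk_surjective (b i)).choose,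
      fun i ↦ (TensorProduct.mk_surjective R M _ Ideal.Quotient.mk_surjective (b i)).choose_spec⟩
  have hspan : Submodule.span R (Set.range v) = ⊤ :=
    IsLocalRing.span_eq_top_of_tmul_eq_basis v b hv
  let φ : (Fin s → R) →ₗ[R] M := Fintype.linearCombination R v
  have hφ : Function.Surjective φ := by
    rw [← LinearMap.range_eq_top, Fintype.range_linearCombination, hspan]
  suffices hinj : Function.Injective φ from
    Module.Free.of_equiv (LinearEquiv.ofBijective φ ⟨hinj, hφ⟩)
  rw [injective_iff_map_eq_zero]
  intro x hx
  ext i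
  suffices hnil : x i ∈ nilradical R by
    rw [nilradical_eq_zero, Ideal.zero_eq_bot, Ideal.mem_bot] at hnil
    exact hnil
  rw [nilradical_eq_sInf, Submodule.mem_sInf]
  rintro q (hq : Ideal.IsPrime q)
  -- compare dimensions over `κ(q)`
  let K := Ideal.ResidueField q
  let φK : K ⊗[R] (Fin s → R) →ₗ[K] K ⊗[R] M := φ.baseChange K
  have hsurjK : Function.Surjective φK := LinearMap.lTensor_surjective K hφ
  have h1 : Module.finrank K (K ⊗[R] (Fin s → R)) = s := by
    rw [Module.finrank_baseChange, Module.finrank_fin_fun]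
  have h2 : Module.finrank K (K ⊗[R] M) = s := h ⟨q, hq⟩
  have hinjK : Function.Injective φK :=
    (LinearMap.injective_iff_surjective_of_finrank_eq_finrank (h1.trans h2.symm)).mpr hsurjK
  have hx0 : (1 : K) ⊗ₜ[R] x = 0 := hinjK (by rw [map_zero, LinearMap.baseChange_tmul, hx,
    TensorProduct.tmul_zero])
  -- extract the `i`-th coordinate
  have := congrArg (fun t ↦ TensorProduct.AlgebraTensorModule.rid R K K
    ((LinearMap.proj i : (Fin s → R) →ₗ[R] R).baseChange K t)) hx0
  simp only [LinearMap.baseChange_tmul, LinearMap.coe_proj, Function.eval, map_zero,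
    TensorProduct.AlgebraTensorModule.rid_tmul] at this
  rwa [← Ideal.algebraMap_residueField_eq_zero, Algebra.algebraMap_eq_smul_one]

/-- Fibre ranks are unchanged by localising the module: `L ⊗_S N = L ⊗_R M` when `N = S ⊗_R M`.
[folklore] -/
theorem finrank_tensor_eq_of_isBaseChange {S : Type*} [CommRing S] [Algebra R S] {N : Type*}
    [AddCommGroup N] [Module R N] [Module S N] [IsScalarTower R S N] {f : M →ₗ[R] N}
    (hf : IsBaseChange S f) (L : Type*) [Field L] [Algebra R L] [Algebra S L]
    [IsScalarTower R S L] :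
    Module.finrank L (L ⊗[S] N) = Module.finrank L (L ⊗[R] M) :=
  LinearEquiv.finrank_eq ((hf.equiv.symm.baseChange S L _ _).trans
    (TensorProduct.AlgebraTensorModule.cancelBaseChange R S L L M))

/-- **Constant fibre rank over a reduced ring implies flat.** If `R` is reduced, `M` is a finite
`R`-module and `p ↦ dim_{κ(p)} (κ(p) ⊗_R M)` is constant on `Spec R`, then `M` is flat (indeed
locally free: Görtz–Wedhorn I, Cor. 11.19, stated there without noetherian hypotheses;
Hartshorne II Ex. 5.8 (c) for `R` noetherian). [folklore] -/
theorem flat_of_fibreRank_eq_const [IsReduced R] [Module.Finite R M] (r : ℕ)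
    (h : ∀ p : PrimeSpectrum R, fibreRank M p = r) : Module.Flat R M := by
  refine Module.flat_of_localized_maximal M fun P _ ↦ ?_
  have hP : ∀ (L : Type u) [Field L] [Algebra R L] [Algebra (Localization.AtPrime P) L]
      [IsScalarTower R (Localization.AtPrime P) L],
      Module.finrank L (L ⊗[Localization.AtPrime P] LocalizedModule P.primeCompl M) =
        Module.finrank L (L ⊗[R] M) := fun L _ _ _ _ ↦
    finrank_tensor_eq_of_isBaseChange (LocalizedModule.isBaseChange P.primeCompl M) L
  have hfree : Module.Free (Localization.AtPrime P) (LocalizedModule P.primeCompl M) := by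
    refine free_of_fibreRank_eq fun Q ↦ ?_
    rw [fibreRank, hP, hP]
    let q : PrimeSpectrum R := ⟨Q.asIdeal.comap (algebraMap R (Localization.AtPrime P)),
      inferInstance⟩
    let ψ : q.asIdeal.ResidueField →ₐ[R] Q.asIdeal.ResidueField :=
      Ideal.ResidueField.mapₐ q.asIdeal Q.asIdeal (Algebra.ofId R (Localization.AtPrime P)) rfl
    letI : Algebra q.asIdeal.ResidueField Q.asIdeal.ResidueField := ψ.toRingHom.toAlgebra
    haveI : IsScalarTower R q.asIdeal.ResidueField Q.asIdeal.ResidueField :=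
      IsScalarTower.of_algebraMap_eq fun x ↦ (ψ.commutes x).symm
    rw [finrank_tensor_eq_of_isScalarTower q.asIdeal.ResidueField Q.asIdeal.ResidueField]
    exact (h q).trans (h ⟨P, inferInstance⟩).symm
  have : Module.Flat R (Localization.AtPrime P) := IsLocalization.flat _ P.primeCompl
  exact Module.Flat.trans R (Localization.AtPrime P) _

end FibreRank

section AbelianVariety
open Literature.AlgebraicGeometry.Motives (AbelianVariety)
open Literature.AlgebraicGeometry.Motives.AbelianVariety

open scoped MonObj

variable {K : Type u} [Field K] {A B : AbelianVariety K}

/-! ### Group operations on scheme-valued points -/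

section Points

variable {Z Z' : Scheme.{u}}

/-- A `Z`-valued point `x : Z → A` makes `Z` a `K`-scheme, `Z → A → Spec K`. [folklore] -/
abbrev _root_.Literature.AlgebraicGeometry.Motives.AbelianVariety.overOf (x : Z ⟶ A.X.left) : Literature.AlgebraicGeometry.Motives.SchemeOver K := Over.mk (x ≫ A.X.hom)

/-- The point `x` as a morphism of `K`-schemes `overOf x → A`. [folklore] -/
abbrev _root_.Literature.AlgebraicGeometry.Motives.AbelianVariety.ptOf (x : Z ⟶ A.X.left) : overOf x ⟶ A.X := Over.homMk x rfl

/-- A second point `b : Z → A` over the same structure map, as a morphism `overOf x → A`.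
[folklore] -/
abbrev _root_.Literature.AlgebraicGeometry.Motives.AbelianVariety.ptOf' (x b : Z ⟶ A.X.left) (hb : b ≫ A.X.hom = x ≫ A.X.hom) : overOf x ⟶ A.X :=
  Over.homMk b hb

/-- The point `x⁻¹ b : Z → A` (group law of `A` on `Z`-valued points over `K`). [folklore] -/
def _root_.Literature.AlgebraicGeometry.Motives.AbelianVariety.divPt (x b : Z ⟶ A.X.left) (hb : b ≫ A.X.hom = x ≫ A.X.hom) : Z ⟶ A.X.left :=
  ((ptOf x)⁻¹ * ptOf' x b hb).left

/-- The point `x c : Z → A` (group law of `A` on `Z`-valued points over `K`). [folklore] -/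
def _root_.Literature.AlgebraicGeometry.Motives.AbelianVariety.mulPt (x c : Z ⟶ A.X.left) (hc : c ≫ A.X.hom = x ≫ A.X.hom) : Z ⟶ A.X.left :=
  (ptOf x * ptOf' x c hc).left

/-- `x⁻¹ b` lies over the same structure map as `x`. [folklore] -/
@[simp]
theorem _root_.Literature.AlgebraicGeometry.Motives.AbelianVariety.divPt_comp_hom (x b : Z ⟶ A.X.left) (hb : b ≫ A.X.hom = x ≫ A.X.hom) :
    divPt x b hb ≫ A.X.hom = x ≫ A.X.hom :=
  Over.w _

/-- `x c` lies over the same structure map as `x`. [folklore] -/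
@[simp]
theorem _root_.Literature.AlgebraicGeometry.Motives.AbelianVariety.mulPt_comp_hom (x c : Z ⟶ A.X.left) (hc : c ≫ A.X.hom = x ≫ A.X.hom) :
    mulPt x c hc ≫ A.X.hom = x ≫ A.X.hom :=
  Over.w _

/-- Precomposition lifts to a morphism of `K`-schemes `overOf (g ≫ x) → overOf x`. [folklore] -/
abbrev _root_.Literature.AlgebraicGeometry.Motives.AbelianVariety.overOfMap (g : Z' ⟶ Z) (x : Z ⟶ A.X.left) : overOf (g ≫ x) ⟶ overOf x :=
  Over.homMk g (Category.assoc _ _ _).symm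

/-- `ptOf` is natural in `Z`. [folklore] -/
theorem _root_.Literature.AlgebraicGeometry.Motives.AbelianVariety.overOfMap_comp_ptOf (g : Z' ⟶ Z) (x : Z ⟶ A.X.left) :
    overOfMap g x ≫ ptOf x = ptOf (g ≫ x) :=
  Over.OverMorphism.ext rfl

/-- `ptOf'` is natural in `Z`. [folklore] -/
theorem _root_.Literature.AlgebraicGeometry.Motives.AbelianVariety.overOfMap_comp_ptOf' (g : Z' ⟶ Z) (x b : Z ⟶ A.X.left)
    (hb : b ≫ A.X.hom = x ≫ A.X.hom) :
    overOfMap g x ≫ ptOf' x b hb =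
      ptOf' (g ≫ x) (g ≫ b) (by rw [Category.assoc, hb, Category.assoc]) :=
  Over.OverMorphism.ext rfl

/-- `divPt` is natural in `Z`: `g ≫ x⁻¹ b = (g ≫ x)⁻¹ (g ≫ b)`. [folklore] -/
theorem _root_.Literature.AlgebraicGeometry.Motives.AbelianVariety.comp_divPt (g : Z' ⟶ Z) (x b : Z ⟶ A.X.left) (hb : b ≫ A.X.hom = x ≫ A.X.hom)
    {x' b' : Z' ⟶ A.X.left} (hx : g ≫ x = x') (hb' : g ≫ b = b')
    (h' : b' ≫ A.X.hom = x' ≫ A.X.hom) :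
    g ≫ divPt x b hb = divPt x' b' h' := by
  subst hx hb'
  have : overOfMap g x ≫ ((ptOf x)⁻¹ * ptOf' x b hb) =
      (ptOf (g ≫ x))⁻¹ * ptOf' (g ≫ x) (g ≫ b) h' := by
    rw [MonObj.comp_mul, GrpObj.comp_inv, overOfMap_comp_ptOf, overOfMap_comp_ptOf']
  exact congrArg CommaMorphism.left this

/-- `mulPt` is natural in `Z`: `g ≫ x c = (g ≫ x) (g ≫ c)`. [folklore] -/
theorem _root_.Literature.AlgebraicGeometry.Motives.AbelianVariety.comp_mulPt (g : Z' ⟶ Z) (x c : Z ⟶ A.X.left) (hc : c ≫ A.X.hom = x ≫ A.X.hom)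
    {x' c' : Z' ⟶ A.X.left} (hx : g ≫ x = x') (hc' : g ≫ c = c')
    (h' : c' ≫ A.X.hom = x' ≫ A.X.hom) :
    g ≫ mulPt x c hc = mulPt x' c' h' := by
  subst hx hc'
  have : overOfMap g x ≫ (ptOf x * ptOf' x c hc) =
      ptOf (g ≫ x) * ptOf' (g ≫ x) (g ≫ c) h' := by
    rw [MonObj.comp_mul, overOfMap_comp_ptOf, overOfMap_comp_ptOf']
  exact congrArg CommaMorphism.left this

/-- `x (x⁻¹ b) = b`. [folklore] -/
theorem _root_.Literature.AlgebraicGeometry.Motives.AbelianVariety.mulPt_divPt (x b : Z ⟶ A.X.left) (hb : b ≫ A.X.hom = x ≫ A.X.hom) :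
    mulPt x (divPt x b hb) (divPt_comp_hom x b hb) = b := by
  have h : ptOf' x (divPt x b hb) (divPt_comp_hom x b hb) = (ptOf x)⁻¹ * ptOf' x b hb :=
    Over.OverMorphism.ext rfl
  have : ptOf x * ptOf' x (divPt x b hb) (divPt_comp_hom x b hb) = ptOf' x b hb := by
    rw [h, mul_inv_cancel_left]
  exact congrArg CommaMorphism.left this

/-- `x⁻¹ (x c) = c`. [folklore] -/
theorem _root_.Literature.AlgebraicGeometry.Motives.AbelianVariety.divPt_mulPt (x c : Z ⟶ A.X.left) (hc : c ≫ A.X.hom = x ≫ A.X.hom) :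
    divPt x (mulPt x c hc) (mulPt_comp_hom x c hc) = c := by
  have h : ptOf' x (mulPt x c hc) (mulPt_comp_hom x c hc) = ptOf x * ptOf' x c hc :=
    Over.OverMorphism.ext rfl
  have : (ptOf x)⁻¹ * ptOf' x (mulPt x c hc) (mulPt_comp_hom x c hc) = ptOf' x c hc := by
    rw [h, inv_mul_cancel_left]
  exact congrArg CommaMorphism.left this

variable (B) in
/-- The unit section `e_B : Spec K → B` of the group scheme underlying `B`. [folklore] -/
abbrev _root_.Literature.AlgebraicGeometry.Motives.AbelianVariety.unitPt : Spec (.of K) ⟶ B.X.left := η[B.X].left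

/-- The unit section is a section of `B → Spec K`. [folklore] -/
@[simp]
theorem _root_.Literature.AlgebraicGeometry.Motives.AbelianVariety.unitPt_comp_hom : unitPt B ≫ B.X.hom = 𝟙 _ := Over.w η[B.X]

/-- A homomorphism commutes with the structure maps to `Spec K`. [folklore] -/
theorem _root_.Literature.AlgebraicGeometry.Motives.AbelianVariety.toSchemeHom_comp_hom (f : A ⟶ B) : Hom.toSchemeHom f ≫ B.X.hom = A.X.hom :=
  Over.w f.hom.hom.hom

/-- The unit of the group `(T ⟶ B.X)` has underlying morphism `T → Spec K → B`. [folklore] -/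
theorem _root_.Literature.AlgebraicGeometry.Motives.AbelianVariety.one_left (T : Literature.AlgebraicGeometry.Motives.SchemeOver K) : (1 : T ⟶ B.X).left = T.hom ≫ unitPt B := rfl

/-- If `f x = f b` then `f (x⁻¹ b) = e`. [folklore] -/
theorem _root_.Literature.AlgebraicGeometry.Motives.AbelianVariety.divPt_comp_toSchemeHom (f : A ⟶ B) (x b : Z ⟶ A.X.left)
    (hb : b ≫ A.X.hom = x ≫ A.X.hom) (h : b ≫ Hom.toSchemeHom f = x ≫ Hom.toSchemeHom f) :
    divPt x b hb ≫ Hom.toSchemeHom f = (x ≫ A.X.hom) ≫ unitPt B := by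
  have hx : IsMonHom.monoidHom f.hom.hom.hom _ (ptOf' x b hb) =
      IsMonHom.monoidHom f.hom.hom.hom _ (ptOf x) :=
    Over.OverMorphism.ext h
  have : IsMonHom.monoidHom f.hom.hom.hom _ ((ptOf x)⁻¹ * ptOf' x b hb) = 1 := by
    rw [map_mul, map_inv, hx, inv_mul_cancel]
  exact congrArg CommaMorphism.left this

/-- If `f c = e` then `f (x c) = f x`. [folklore] -/
theorem _root_.Literature.AlgebraicGeometry.Motives.AbelianVariety.mulPt_comp_toSchemeHom (f : A ⟶ B) (x c : Z ⟶ A.X.left)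
    (hc : c ≫ A.X.hom = x ≫ A.X.hom)
    (h : c ≫ Hom.toSchemeHom f = (x ≫ A.X.hom) ≫ unitPt B) :
    mulPt x c hc ≫ Hom.toSchemeHom f = x ≫ Hom.toSchemeHom f := by
  have hc' : IsMonHom.monoidHom f.hom.hom.hom _ (ptOf' x c hc) = 1 :=
    Over.OverMorphism.ext h
  have : IsMonHom.monoidHom f.hom.hom.hom _ (ptOf x * ptOf' x c hc) =
      IsMonHom.monoidHom f.hom.hom.hom _ (ptOf x) := by
    rw [map_mul, hc', mul_one]
  exact congrArg CommaMorphism.left this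

end Points

/-! ### The scheme-theoretic kernel and the translation isomorphism -/

section Kernel

variable (f : A ⟶ B)

/-- The scheme-theoretic kernel `Ker f = A ×_{B, e} Spec K` of a homomorphism of abelian
varieties (Görtz–Wedhorn II, (27.1.1), PDF p. 800; Mumford §12). [folklore] -/
abbrev _root_.Literature.AlgebraicGeometry.Motives.AbelianVariety.Hom.ker : Scheme.{u} := pullback (Hom.toSchemeHom f) (unitPt B)

/-- The inclusion `Ker f → A` (base change of the unit section `Spec K → B`). [folklore] -/
abbrev _root_.Literature.AlgebraicGeometry.Motives.AbelianVariety.Hom.kerι : Hom.ker f ⟶ A.X.left := pullback.fst _ _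

/-- The structure morphism `Ker f → Spec K`. [folklore] -/
abbrev _root_.Literature.AlgebraicGeometry.Motives.AbelianVariety.Hom.kerToSpec : Hom.ker f ⟶ Spec (.of K) := pullback.snd _ _

/-- The structure map of `Ker f` is `Ker f → A → Spec K`. [folklore] -/
theorem _root_.Literature.AlgebraicGeometry.Motives.AbelianVariety.Hom.kerι_comp_hom : Hom.kerι f ≫ A.X.hom = Hom.kerToSpec f := by
  rw [← toSchemeHom_comp_hom f, pullback.condition_assoc, unitPt_comp_hom, Category.comp_id]

/-- `f` vanishes on `Ker f`: `Ker f → A → B` is `Ker f → Spec K → B`. [folklore] -/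
theorem _root_.Literature.AlgebraicGeometry.Motives.AbelianVariety.Hom.kerι_comp_toSchemeHom :
    Hom.kerι f ≫ Hom.toSchemeHom f = (Hom.kerι f ≫ A.X.hom) ≫ unitPt B := by
  rw [Hom.kerι_comp_hom]; exact pullback.condition

variable {F : Scheme.{u}} (w : F ⟶ B.X.left) (z : F ⟶ A.X.left) (hw : z ≫ Hom.toSchemeHom f = w)

/-- Forward map of `transIso`: `(a, y) ↦ (y, z(y)⁻¹ a)`. [folklore] -/
def _root_.Literature.AlgebraicGeometry.Motives.AbelianVariety.transHom : pullback (Hom.toSchemeHom f) w ⟶ pullback (z ≫ A.X.hom) (Hom.kerToSpec f) :=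
  pullback.lift (pullback.snd _ _)
    (pullback.lift
      (divPt (pullback.snd _ _ ≫ z) (pullback.fst _ _) (by
        rw [Category.assoc, ← toSchemeHom_comp_hom f, pullback.condition_assoc, reassoc_of% hw]))
      ((pullback.snd _ _ ≫ z) ≫ A.X.hom)
      (divPt_comp_toSchemeHom f _ _ _ (by rw [pullback.condition, Category.assoc, hw])))
    (by rw [pullback.lift_snd, Category.assoc])

/-- First component of `transHom`. [folklore] -/
@[reassoc (attr := simp)]
theorem _root_.Literature.AlgebraicGeometry.Motives.AbelianVariety.transHom_fst : transHom f w z hw ≫ pullback.fst _ _ = pullback.snd _ _ :=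
  pullback.lift_fst _ _ _

/-- Second component of `transHom`, followed by `Ker f → A`. [folklore] -/
@[reassoc]
theorem _root_.Literature.AlgebraicGeometry.Motives.AbelianVariety.transHom_snd_kerι : transHom f w z hw ≫ pullback.snd _ _ ≫ Hom.kerι f =
    divPt (pullback.snd _ _ ≫ z) (pullback.fst _ _) (by
      rw [Category.assoc, ← toSchemeHom_comp_hom f, pullback.condition_assoc, reassoc_of% hw]) := by
  rw [transHom, pullback.lift_snd_assoc, pullback.lift_fst]

/-- Second component of `transHom`, followed by `Ker f → Spec K`. [folklore] -/
@[reassoc]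
theorem _root_.Literature.AlgebraicGeometry.Motives.AbelianVariety.transHom_snd_kerToSpec : transHom f w z hw ≫ pullback.snd _ _ ≫ Hom.kerToSpec f =
    pullback.snd _ _ ≫ z ≫ A.X.hom := by
  rw [transHom, pullback.lift_snd_assoc, pullback.lift_snd, Category.assoc]

/-- Inverse map of `transIso`: `(y, k) ↦ (z(y) k, y)`. [folklore] -/
def _root_.Literature.AlgebraicGeometry.Motives.AbelianVariety.transInv : pullback (z ≫ A.X.hom) (Hom.kerToSpec f) ⟶ pullback (Hom.toSchemeHom f) w :=
  pullback.lift
    (mulPt (pullback.fst _ _ ≫ z) (pullback.snd _ _ ≫ Hom.kerι f) (by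
      rw [Category.assoc, Hom.kerι_comp_hom, ← pullback.condition, Category.assoc]))
    (pullback.fst _ _)
    (by
      rw [mulPt_comp_toSchemeHom f _ _ _ (by
        simp only [Category.assoc, Hom.kerι_comp_toSchemeHom, Hom.kerι_comp_hom,
          ← pullback.condition_assoc]), Category.assoc, hw])

/-- Second component of `transInv`. [folklore] -/
@[reassoc (attr := simp)]
theorem _root_.Literature.AlgebraicGeometry.Motives.AbelianVariety.transInv_snd : transInv f w z hw ≫ pullback.snd _ _ = pullback.fst _ _ :=
  pullback.lift_snd _ _ _

/-- First component of `transInv`. [folklore] -/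
@[reassoc]
theorem _root_.Literature.AlgebraicGeometry.Motives.AbelianVariety.transInv_fst : transInv f w z hw ≫ pullback.fst _ _ =
    mulPt (pullback.fst _ _ ≫ z) (pullback.snd _ _ ≫ Hom.kerι f) (by
      rw [Category.assoc, Hom.kerι_comp_hom, ← pullback.condition, Category.assoc]) :=
  pullback.lift_fst _ _ _

/-- **Translation isomorphism.** For `z : F → A` and `w = f z : F → B`, the fibre product
`A ×_{B, w} F` is isomorphic over `F` to `F ×_K Ker f`, by `(a, y) ↦ (y, z(y)⁻¹ a)` with inverse
`(y, k) ↦ (z(y) k, y)` (Görtz–Wedhorn II, (27.9.1) in Lemma 27.59, PDF p. 822,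
`(g, h) ↦ (gh, g)`, here with `G/H` replaced by `B` and pulled back along `z`; Mumford §12).
[folklore] -/
def _root_.Literature.AlgebraicGeometry.Motives.AbelianVariety.transIso : pullback (Hom.toSchemeHom f) w ≅ pullback (z ≫ A.X.hom) (Hom.kerToSpec f) where
  hom := transHom f w z hw
  inv := transInv f w z hw
  hom_inv_id := by
    refine pullback.hom_ext ?_ (by simp)
    rw [Category.assoc, transInv_fst, Category.id_comp]
    rw [comp_mulPt _ _ _ _ (x' := pullback.snd _ _ ≫ z)
      (c' := divPt (pullback.snd _ _ ≫ z) (pullback.fst _ _) _) (transHom_fst_assoc ..)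
      (transHom_snd_kerι _ _ _ _) (divPt_comp_hom _ _ _), mulPt_divPt]
  inv_hom_id := by
    refine pullback.hom_ext (by simp) ?_
    rw [Category.assoc, Category.id_comp]
    refine pullback.hom_ext ?_ ?_ <;> simp only [Category.assoc]
    · rw [transHom_snd_kerι]
      rw [comp_divPt _ _ _ _ (x' := pullback.fst _ _ ≫ z)
        (b' := mulPt (pullback.fst _ _ ≫ z) (pullback.snd _ _ ≫ Hom.kerι f) _)
        (transInv_snd_assoc ..) (transInv_fst _ _ _ _) (mulPt_comp_hom _ _ _), divPt_mulPt]
    · rw [transHom_snd_kerToSpec, transInv_snd_assoc, pullback.condition]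

/-- `transIso` is an isomorphism over `F`. [folklore] -/
@[reassoc (attr := simp)]
theorem _root_.Literature.AlgebraicGeometry.Motives.AbelianVariety.transIso_hom_fst : (transIso f w z hw).hom ≫ pullback.fst _ _ = pullback.snd _ _ :=
  transHom_fst f w z hw

end Kernel

/-! ### Flatness of isogenies -/

section Flat

variable (f : A ⟶ B)

/-- The rank `dim_K Γ(Ker f, 𝒪)` of the (affine) kernel of `f`; for an isogeny this is the order
of the finite group scheme `Ker f`, i.e. `deg f` (Görtz–Wedhorn II, Cor. 27.177). For a general
homomorphism `f` this number is still finite (`Ker f` is a closed subscheme of the proper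
`K`-scheme `A`, so `Γ(Ker f, 𝒪)` is finite-dimensional), but it is the order of a finite group
scheme only when `Ker f` is finite over `K`: e.g. for `f = 0` one has `Ker f ≅ A` and the value
is `dim_K Γ(A, 𝒪_A) = 1` (`A` being proper and geometrically integral), unrelated to any
degree. [folklore] -/
def _root_.Literature.AlgebraicGeometry.Motives.AbelianVariety.Hom.kerRank : ℕ :=
  letI := (Hom.kerToSpec f).appTop.hom.toAlgebra
  Module.finrank Γ(Spec (.of K), ⊤) Γ(Hom.ker f, ⊤)

omit [Field K] in
/-- `Γ` of the inverse of `X ≅ Spec Γ(X)` is the inverse of `Γ(Spec R) ≅ R`. [folklore] -/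
theorem _root_.Literature.AlgebraicGeometry.Motives.AbelianVariety.isoSpec_inv_appTop (X : Scheme.{u}) [IsAffine X] :
    X.isoSpec.inv.appTop = (Scheme.ΓSpecIso Γ(X, ⊤)).inv := by
  have h := congrArg Scheme.Hom.appTop X.isoSpec.hom_inv_id
  rw [Scheme.Hom.comp_appTop, Scheme.isoSpec_hom, Scheme.toSpecΓ_appTop, Scheme.Hom.id_appTop]
    at h
  exact (Iso.comp_hom_eq_id _).mp h

open FibreRank in
/-- **The fibre rank of an isogeny is constant.** For an isogeny `f : A → B`, an affine scheme
`U → B` and the finite algebra `R = Γ(U) → S = Γ(A ×_B U)`, the fibre rank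
`dim_{κ(p)} (κ(p) ⊗_R S)` at every prime `p` of `R` equals `dim_K Γ(Ker f, 𝒪)`: the fibre `F`
of `f` over `p` satisfies `F ×_U (A ×_B U) ≅ F ×_B A ≅ F ×_K Ker f` (`transIso`), and global
sections of these affine fibre products are the tensor products `Γ(F) ⊗_R S`, `Γ(F) ⊗_K Γ(Ker f)`
(Görtz–Wedhorn II, (27.9.1) and the proof of Cor. 27.177, PDF p. 882).
[cite: GortzWedhorn2023, Cor. 27.177 (1)] -/
theorem _root_.Literature.AlgebraicGeometry.Motives.AbelianVariety.IsIsogeny.fibreRank_eq_kerRank {f : A ⟶ B} (hf : IsIsogeny f) {U : Scheme.{u}}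
    [IsAffine U] (g : U ⟶ B.X.left) (p : PrimeSpectrum Γ(U, ⊤)) :
    letI := (pullback.snd (Hom.toSchemeHom f) g).appTop.hom.toAlgebra
    fibreRank Γ(pullback (Hom.toSchemeHom f) g, ⊤) p = Hom.kerRank f := by
  obtain ⟨hsurj, hfin⟩ := hf
  -- the restriction `f' : X' → U` of `f` over `U`
  let X' := pullback (Hom.toSchemeHom f) g
  let f' : X' ⟶ U := pullback.snd (Hom.toSchemeHom f) g
  have : IsAffine X' := isAffine_of_isAffineHom f'
  have hf's : Surjective f' := MorphismProperty.pullback_snd _ _ hsurj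
  let R := Γ(U, ⊤)
  let S := Γ(X', ⊤)
  letI : Algebra R S := f'.appTop.hom.toAlgebra
  change fibreRank S p = Hom.kerRank f
  -- the fibre `F` over `p`
  let κ := p.asIdeal.ResidueField
  let Z := Spec (.of κ)
  let z : Z ⟶ U := Spec.map (CommRingCat.ofHom (algebraMap R κ)) ≫ U.isoSpec.inv
  let F := pullback f' z
  let q₁ : F ⟶ X' := pullback.fst f' z
  let q₂ : F ⟶ Z := pullback.snd f' z
  have : IsAffine F := isAffine_of_isAffineHom q₂
  have hq₂ : Surjective q₂ := MorphismProperty.pullback_snd _ _ hf's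
  let zF : F ⟶ U := q₂ ≫ z
  let zX : F ⟶ A.X.left := q₁ ≫ pullback.fst (Hom.toSchemeHom f) g
  have hw : zX ≫ Hom.toSchemeHom f = zF ≫ g := by
    simp only [zX, zF, q₁, q₂, Category.assoc, pullback.condition]
    rw [pullback.condition_assoc]
  let pF : F ⟶ Spec (.of K) := zX ≫ A.X.hom
  -- the two fibre products and the translation isomorphism between them
  let P₁ := pullback f' zF
  let P₂ := pullback pF (Hom.kerToSpec f)
  let Φ : P₁ ≅ P₂ := pullbackLeftPullbackSndIso (Hom.toSchemeHom f) g zF ≪≫ transIso f (zF ≫ g) zX hw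
  have hΦ : Φ.hom ≫ pullback.fst _ _ = pullback.snd _ _ := by
    change (_ ≫ (transIso f (zF ≫ g) zX hw).hom) ≫ pullback.fst (zX ≫ A.X.hom) (Hom.kerToSpec f) =
      _
    rw [Category.assoc, transIso_hom_fst, pullbackLeftPullbackSndIso_hom_snd]
  -- rings of global sections
  let C := Γ(F, ⊤)
  let D₁ := Γ(P₁, ⊤)
  let D₂ := Γ(P₂, ⊤)
  let k' := Γ(Spec (.of K), ⊤)
  let H := Γ(Hom.ker f, ⊤)
  have : Nonempty (⊤ : F.Opens) := by
    obtain ⟨y, -⟩ := q₂.surjective (Classical.arbitrary Z)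
    exact ⟨⟨y, trivial⟩⟩
  have : Nontrivial C := Scheme.component_nontrivial F ⊤
  -- `Γ(F ×_U X') = C ⊗_R S`
  have h₁ := isPushout_appTop_of_isPullback (IsPullback.of_hasPullback f' zF).flip
  algebraize [zF.appTop.hom, (pullback.snd f' zF).appTop.hom, (pullback.fst f' zF).appTop.hom,
    (pullback.snd f' zF).appTop.hom.comp zF.appTop.hom]
  have : IsScalarTower R S D₁ := .of_algebraMap_eq' congr($(h₁.w).hom)
  have hP₁ : Algebra.IsPushout R C S D₁ := CommRingCat.isPushout_iff_isPushout.mp h₁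
  let e₁ : C ⊗[R] S ≃ₐ[C] D₁ := Algebra.IsPushout.equiv R C S D₁
  -- `Γ(F ×_K Ker f) = C ⊗_K Γ(Ker f)`
  have : IsAffine (Hom.ker f) := isAffine_of_isAffineHom (Hom.kerToSpec f)
  have h₂ := isPushout_appTop_of_isPullback (IsPullback.of_hasPullback pF (Hom.kerToSpec f))
  algebraize [pF.appTop.hom, (Hom.kerToSpec f).appTop.hom,
    (pullback.fst pF (Hom.kerToSpec f)).appTop.hom, (pullback.snd pF (Hom.kerToSpec f)).appTop.hom,
    (pullback.fst pF (Hom.kerToSpec f)).appTop.hom.comp pF.appTop.hom]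
  have : IsScalarTower k' H D₂ := .of_algebraMap_eq' congr($(h₂.w).hom)
  have hP₂ : Algebra.IsPushout k' C H D₂ := CommRingCat.isPushout_iff_isPushout.mp h₂
  let e₂ : C ⊗[k'] H ≃ₐ[C] D₂ := Algebra.IsPushout.equiv k' C H D₂
  -- `Γ(Φ) : D₂ ≃ D₁` over `C`
  let eR : D₂ ≃+* D₁ := (Scheme.Γ.mapIso Φ.op).commRingCatIsoToRingEquiv
  have hΦ' : (pullback.fst pF (Hom.kerToSpec f)).appTop ≫ Φ.hom.appTop =
      (pullback.snd f' zF).appTop := by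
    rw [← Scheme.Hom.comp_appTop, hΦ]
  have he : ∀ c : C, eR (algebraMap C D₂ c) = algebraMap C D₁ c := fun c ↦
    congr($(hΦ').hom c)
  let e : D₂ ≃ₐ[C] D₁ := AlgEquiv.ofRingEquiv he
  -- `C` is a `κ(p)`-algebra compatibly with `R`
  letI : Algebra κ C := ((Scheme.ΓSpecIso (.of κ)).inv ≫ q₂.appTop).hom.toAlgebra
  have hzF : zF.appTop = CommRingCat.ofHom (algebraMap R κ) ≫ (Scheme.ΓSpecIso (.of κ)).inv ≫
      q₂.appTop := by
    simp only [zF, z, Scheme.Hom.comp_appTop, isoSpec_inv_appTop, Category.assoc]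
    rw [← Scheme.ΓSpecIso_inv_naturality_assoc]
  have : IsScalarTower R κ C := .of_algebraMap_eq' congr($(hzF).hom)
  -- `Γ(Spec K)` is a field
  letI : Field k' := ((Scheme.ΓSpecIso (.of K)).commRingCatIsoToRingEquiv.toMulEquiv.isField
    (Field.toIsField K)).toField
  -- count dimensions
  calc fibreRank S p = Module.finrank κ (κ ⊗[R] S) := rfl
    _ = Module.finrank C (C ⊗[κ] (κ ⊗[R] S)) := (Module.finrank_baseChange ..).symm
    _ = Module.finrank C (C ⊗[R] S) :=
      (TensorProduct.AlgebraTensorModule.cancelBaseChange R κ C C S).finrank_eq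
    _ = Module.finrank C D₁ := e₁.toLinearEquiv.finrank_eq
    _ = Module.finrank C D₂ := e.toLinearEquiv.finrank_eq.symm
    _ = Module.finrank C (C ⊗[k'] H) := e₂.toLinearEquiv.finrank_eq.symm
    _ = Module.finrank k' H := Module.finrank_baseChange ..
    _ = Hom.kerRank f := rfl

/-- **Isogenies are flat, affine-locally on the target.** For an isogeny `f : A → B` and a reduced
affine scheme `U → B`, the base change `A ×_B U → U` is flat: it is `Spec` of a finite algebra
over the reduced ring `Γ(U)` with constant fibre rank (`IsIsogeny.fibreRank_eq_kerRank`), hence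
flat (`FibreRank.flat_of_fibreRank_eq_const`) (Görtz–Wedhorn II, Prop. 27.54 and
Cor. 27.177 (1)). [cite: GortzWedhorn2023, Prop. 27.54] -/
theorem _root_.Literature.AlgebraicGeometry.Motives.AbelianVariety.IsIsogeny.flat_pullback_snd {f : A ⟶ B} (hf : IsIsogeny f) {U : Scheme.{u}} [IsAffine U]
    [IsReduced U] (g : U ⟶ B.X.left) : Flat (pullback.snd (Hom.toSchemeHom f) g) := by
  have := hf.2
  have : IsAffine (pullback (Hom.toSchemeHom f) g) :=
    isAffine_of_isAffineHom (pullback.snd (Hom.toSchemeHom f) g)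
  rw [HasRingHomProperty.iff_of_isAffine (P := @Flat)]
  have hfin := (pullback.snd (Hom.toSchemeHom f) g).finite_appTop
  algebraize [(pullback.snd (Hom.toSchemeHom f) g).appTop.hom]
  exact FibreRank.flat_of_fibreRank_eq_const (Hom.kerRank f) fun p ↦ hf.fibreRank_eq_kerRank g p

/-- **Isogenies are flat** (Görtz–Wedhorn II, Prop. 27.54; Cor. 27.177 (1): an isogeny is finite
locally free). This discharges the named fact `IsIsogeny.flat_toSchemeHom`: flatness is local on
the target, `B` is covered by reduced affine opens (it is integral), and over each of them `f` is
flat by `IsIsogeny.flat_pullback_snd`. [cite: GortzWedhorn2023, Prop. 27.54] -/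
theorem _root_.Literature.AlgebraicGeometry.Motives.AbelianVariety.IsIsogeny.flat_toSchemeHom_holds : IsIsogeny.flat_toSchemeHom (A := A) (B := B) := by
  intro f hf
  refine IsZariskiLocalAtTarget.of_openCover (P := @Flat) B.X.left.affineCover fun i ↦ ?_
  have : IsReduced (B.X.left.affineCover.X i) :=
    isReduced_of_isOpenImmersion (B.X.left.affineCover.f i)
  exact hf.flat_pullback_snd (B.X.left.affineCover.f i)

/-- An isogeny is flat (instance-style corollary of `IsIsogeny.flat_toSchemeHom_holds`).
[cite: GortzWedhorn2023, Prop. 27.54] -/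
theorem _root_.Literature.AlgebraicGeometry.Motives.AbelianVariety.IsIsogeny.flat {f : A ⟶ B} (hf : IsIsogeny f) : Flat (Hom.toSchemeHom f) :=
  IsIsogeny.flat_toSchemeHom_holds hf

/-- **The quotient property of isogenies holds unconditionally**: if `f : A → B` is an isogeny and
`h : A → C` kills `Ker f` scheme-theoretically, then `h` factors through `f` (discharges the named
fact `IsIsogeny.exists_comp_eq_of_kerPoints_le` of `AVIsogenyQuasiInverse`, by fpqc descent
`IsIsogeny.exists_comp_eq_of_kerPoints_le_of_flat` and flatness `IsIsogeny.flat_toSchemeHom_holds`;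
Görtz–Wedhorn II, §(27.33) p. 882 (1)). [cite: GortzWedhorn2023, §(27.33) p. 882 (1)] -/
theorem _root_.Literature.AlgebraicGeometry.Motives.AbelianVariety.IsIsogeny.exists_comp_eq_of_kerPoints_le_holds {C : AbelianVariety K} :
    IsIsogeny.exists_comp_eq_of_kerPoints_le (A := A) (B := B) (C := C) :=
  IsIsogeny.exists_comp_eq_of_kerPoints_le_of_flat_toSchemeHom IsIsogeny.flat_toSchemeHom_holds

/-- **Quasi-inverse of an isogeny, reduced to Deligne's theorem.** The target fact
`IsIsogeny.exists_nsmul_inverse` (Mumford §19, Remark p. 169; Görtz–Wedhorn II, Prop. 27.190)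
now follows from the single remaining named input `IsIsogeny.exists_kerPoints_le_nsmul`
(the kernel of an isogeny is killed by a positive integer; Görtz–Wedhorn II, Prop. 27.86).
[cite: GortzWedhorn2023, Prop. 27.190] -/
theorem _root_.Literature.AlgebraicGeometry.Motives.AbelianVariety.IsIsogeny.exists_nsmul_inverse_of_exists_kerPoints_le_nsmul
    (h₂ : IsIsogeny.exists_kerPoints_le_nsmul (A := A) (B := B)) :
    IsIsogeny.exists_nsmul_inverse (A := A) (B := B) :=
  IsIsogeny.exists_nsmul_inverse_of_flat_toSchemeHom h₂ IsIsogeny.flat_toSchemeHom_holds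

end Flat

end AbelianVariety

end Literature.NumberTheory.DiophantineGeometry
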